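import Literature.AlgebraicGeometry.Resolution.ProjectiveModelsFunctionField
import Literature.AlgebraicGeometry.Motives.SubschemeCyclesDimProofs
import Literature.AlgebraicGeometry.Motives.BettiCycleClassProofs
import Mathlib.AlgebraicGeometry.Geometrically.Irreducible
import Mathlib.AlgebraicGeometry.Morphisms.Flat
import Mathlib.AlgebraicGeometry.Morphisms.UniversallyOpen
import Mathlib.AlgebraicGeometry.Fiber
import HarnessLib

/-!
# `WildQuotients.SummitReduction` (stmt-ResolutionOfSingularities-16324), line `FramePerfect`, stub 1a:
# the generic fibre of a morphism of projective models — geometric irreducibility and dimension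

Route `ResolutionOfSingularities/WildQuotients`, crux `SummitReduction`; helper file of stub
`stub_pair_equivariantFibration` (de Jong 1997, Lemma 5.2). For a dominant `k`-morphism
`f : X → Y` between projective models `X` of `K/k` and `Y` of `L/k` (`L ⊆ K`) compatible with
the generic points, this file proves the two properties of the GENERIC FIBRE `X_η = X ×_Y Spec κ(η)`
asked by the stub:

* `IsPullback.of_comp_mono'` — bookkeeping: a pullback square over `f ≫ i`, `g ≫ i` with `i` mono
  is a pullback square over `f`, `g`;
* `irreducibleSpace_of_isPullback_of_isDomain_tensor` — if `K ⊗ₗ M` is a domain for the field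
  `M`, every base change `X ×_Y Spec M` along an `M`-point over the generic point of `Y` is
  irreducible: it is flat over `X`, so the generic points of its components lie over the generic
  point `ξ` of `X` (going down), and its fibre over `ξ` is `Spec (M ⊗ₗ K)`;
* `geometricallyIrreducible_fiberToSpecResidueField_genericPoint` — hence the generic fibre is
  geometrically irreducible (Mathlib's `GeometricallyIrreducible`) as soon as `K ⊗ₗ M` is a
  domain for EVERY field `M ⊇ L` (regularity of `K/L`, the sibling file `…TensorLemmas`);
* `topologicalKrullDim_fiber_genericPoint` — and its dimension is `trdeg_L K` (the dimension of
  a point of a scheme locally of finite type over a field is the transcendence degree of its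
  residue field, the tree's `Motives.height_eq_toENat_trdeg_of_isPreimmersion`).
-/

set_option linter.dupNamespace false

noncomputable section

open CategoryTheory CategoryTheory.Limits AlgebraicGeometry TopologicalSpace Topology
open scoped TensorProduct

namespace Summit.ResolutionOfSingularities.ResolutionOfSingularities.Theorems

open Literature.AlgebraicGeometry.Resolution

universe u

/-! ## Pullback squares and monomorphisms -/

/-- A pullback square over `x ≫ i` and `y ≫ i` with `i` a monomorphism is a pullback square over
`x` and `y` (cones over `(x, y)` and over `(x ≫ i, y ≫ i)` coincide). [folklore] -/
theorem IsPullback.of_comp_mono' {C : Type*} [Category C] {P A B W Z : C} {a : P ⟶ A}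
    {b : P ⟶ B} {x : A ⟶ W} {y : B ⟶ W} (i : W ⟶ Z) [Mono i]
    (h : IsPullback a b (x ≫ i) (y ≫ i)) : IsPullback a b x y := by
  have hw : a ≫ x = b ≫ y := (cancel_mono i).mp (by simpa only [Category.assoc] using h.w)
  refine IsPullback.of_isLimit' ⟨hw⟩ (PullbackCone.IsLimit.mk hw
    (fun s => h.lift s.fst s.snd (by rw [reassoc_of% s.condition]))
    (fun s => h.lift_fst _ _ _) (fun s => h.lift_snd _ _ _) ?_)
  intro s m hm₁ hm₂
  exact h.hom_ext (by rw [hm₁, h.lift_fst]) (by rw [hm₂, h.lift_snd])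

/-! ## Base changes along points over the generic point are irreducible -/

section GenericFibre

/-- **Base changes of `X → Y` along field-valued points over the generic point of `Y` are
irreducible when `K ⊗ₗ M` is a domain.** Let `X`, `Y` be projective models of `K ⊇ L` and
`f : X → Y` a `k`-morphism with `gen_X ≫ f = Spec(L ⊆ K) ≫ gen_Y`; let `M ⊇ L` be a field with
`K ⊗ₗ M` a domain and `Z = X ×_Y Spec M` a base change along `Spec M → Spec L → Y`. Then `Z` is
irreducible: `Z → X` is flat (base change of `Spec M → Y`, whose target stalk is the field
`K(Y)`), hence generalizing, so the generic point of every irreducible component of `Z` lies over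
the generic point `ξ` of `X`; and the fibre of `Z → X` over `ξ` is
`Spec K ×_Y Spec M = Spec K ×_{Spec L} Spec M = Spec (M ⊗ₗ K)` (`gen_Y` is a monomorphism),
which is irreducible. (EGA IV₂ 4.5.9: `X_M` is irreducible iff `Spec (K(X) ⊗ M)` is.)
[cite: GrothendieckDieudonne1965, Prop. (4.5.9), p. 61] -/
theorem irreducibleSpace_of_isPullback_of_isDomain_tensor {k K L : Type u} [Field k] [Field K]
    [Field L] [Algebra k K] [Algebra k L] [Algebra L K] (MX : ProjModel k K) (MY : ProjModel k L)
    (f : MX.X ⟶ MY.X)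
    (hgen : MX.gen ≫ f = Spec.map (CommRingCat.ofHom (algebraMap L K)) ≫ MY.gen)
    {M : Type u} [Field M] [Algebra L M]
    [IsDomain (K ⊗[L] M)] {Z : Scheme.{u}} (p₁ : Z ⟶ MX.X) (p₂ : Z ⟶ Spec (.of M))
    (sq : IsPullback p₁ p₂ f (Spec.map (CommRingCat.ofHom (algebraMap L M)) ≫ MY.gen)) :
    IrreducibleSpace Z := by
  classical
  set y' : Spec (.of M) ⟶ MY.X := Spec.map (CommRingCat.ofHom (algebraMap L M)) ≫ MY.gen
    with hy'
  -- `y'` is flat: the stalk of `Y` at the generic point is a field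
  haveI : Flat y' := by
    refine Flat.of_stalkMap _ fun s => ?_
    have hs : y' s = genericPoint MY.X := by
      rw [hy', Scheme.Hom.comp_apply, ProjModel.eq_closedPoint_of_field (Spec.map _ s)]
      exact MY.genericPt_eq
    have hfield : IsField (MY.X.presheaf.stalk (y' s)) := by
      rw [hs]; exact Field.toIsField MY.X.functionField
    exact RingHom.Flat.of_isField hfield _
  haveI : Flat p₁ := MorphismProperty.of_isPullback (P := @Flat) sq.flip inferInstance
  have hgenmap : GeneralizingMap p₁ := Flat.generalizingMap p₁
  -- the fibre of `p₁` over `gen_X`: `W = Spec K ×_X Z ≅ Spec (M ⊗ₗ K)`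
  let W := pullback MX.gen p₁
  have sqW : IsPullback (pullback.snd MX.gen p₁ ≫ p₂) (pullback.fst MX.gen p₁) y'
      (MX.gen ≫ f) := (IsPullback.of_hasPullback MX.gen p₁).flip.paste_horiz sq.flip
  rw [hgen, hy'] at sqW
  haveI : Mono MY.gen := by
    rw [← ProjModel.specMap_funFieldIso_hom_fromSpecStalk]; infer_instance
  have sqW' := IsPullback.of_comp_mono' MY.gen sqW
  haveI : IsDomain (M ⊗[L] K) :=
    MulEquiv.isDomain (K ⊗[L] M) (Algebra.TensorProduct.comm L M K).toMulEquiv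
  haveI : IrreducibleSpace W := by
    let e : W ≅ Spec (.of (M ⊗[L] K)) := sqW'.isoPullback ≪≫ pullbackSpecIso L M K
    haveI : IrreducibleSpace (Spec (.of (M ⊗[L] K)) : Scheme.{u}) :=
      inferInstanceAs (IrreducibleSpace (PrimeSpectrum (M ⊗[L] K)))
    exact e.hom.homeomorph.irreducibleSpace_iff.mpr inferInstance
  -- hence `p₁⁻¹ {ξ}` is irreducible
  have hrange : Set.range (pullback.snd MX.gen p₁) = p₁ ⁻¹' {genericPoint MX.X} := by
    rw [Scheme.Pullback.range_snd, ProjModel.range_gen]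
  have hirr : IsIrreducible (p₁ ⁻¹' {genericPoint MX.X}) := by
    rw [← hrange, ← Set.image_univ]
    exact (IrreducibleSpace.isIrreducible_univ W).image _ (Scheme.Hom.continuous _).continuousOn
  -- every generic point of an irreducible component of `Z` lies over `ξ`
  have hcomp : ∀ z : Z, z ∈ closure (p₁ ⁻¹' {genericPoint MX.X}) := by
    intro z
    obtain ⟨c, hc⟩ := QuasiSober.sober (isIrreducible_irreducibleComponent (x := z))
      isClosed_irreducibleComponent
    -- going down along the flat `p₁`
    obtain ⟨c', hc'c, hc'⟩ := hgenmap (genericPoint_specializes (p₁ c) :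
      genericPoint MX.X ⤳ p₁ c)
    have hsub : irreducibleComponent z ⊆ closure {c'} := by
      rw [← hc.def]
      exact closure_minimal (Set.singleton_subset_iff.mpr hc'c.mem_closure) isClosed_closure
    have heq : closure {c'} = irreducibleComponent z :=
      eq_irreducibleComponent isIrreducible_singleton.closure.isPreirreducible hsub
    have hcc' : c ⤳ c' := by
      rw [specializes_iff_mem_closure, hc.def, ← heq]
      exact subset_closure rfl
    have hcξ : p₁ c = genericPoint MX.X := by rw [(hcc'.antisymm hc'c).eq]; exact hc'
    have hz : z ∈ closure ({c} : Set Z) := by rw [hc.def]; exact mem_irreducibleComponent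
    have hsub' : ({c} : Set Z) ⊆ p₁ ⁻¹' {genericPoint MX.X} := Set.singleton_subset_iff.mpr hcξ
    exact closure_mono hsub' hz
  have huniv : closure (p₁ ⁻¹' {genericPoint MX.X}) = Set.univ := Set.eq_univ_of_forall hcomp
  have hZ : IsIrreducible (Set.univ : Set Z) := by rw [← huniv]; exact hirr.closure
  exact (irreducibleSpace_def Z).mpr hZ

/-- **The generic fibre of `X → Y` is geometrically irreducible when `K ⊗ₗ M` is a domain for
every field `M ⊇ L`** (de Jong 1997, Lemma 5.2: "`R(Y)` is algebraically closed in `R(X')` [and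
the extension is separable]. Hence the generic fibre of `X' → Y` is geometrically reduced and
irreducible"; EGA IV₂ 4.5.9). Here `X`, `Y` are projective models of `K ⊇ L` and `f` a
`k`-morphism compatible with the generic points; a field-valued point `Spec M → Spec κ(η)` of the
residue field of the generic point `η` of `Y` is `Spec M → Spec L → Y` for the induced `L`-algebra
structure on `M` (`κ(η) ≅ K(Y) ≅ L`), so `irreducibleSpace_of_isPullback_of_isDomain_tensor`
applies to every base change of the generic fibre. [cite: DeJong1997, Lemma 5.2 (proof), p. 613] -/
theorem geometricallyIrreducible_fiberToSpecResidueField_genericPoint {k K L : Type u} [Field k] [Field K]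
    [Field L] [Algebra k K] [Algebra k L] [Algebra L K] (MX : ProjModel k K) (MY : ProjModel k L)
    (f : MX.X ⟶ MY.X)
    (hgen : MX.gen ≫ f = Spec.map (CommRingCat.ofHom (algebraMap L K)) ≫ MY.gen)
    (hdom : ∀ (M : Type u) [Field M] [Algebra L M], IsDomain (K ⊗[L] M)) :
    GeometricallyIrreducible (f.fiberToSpecResidueField (genericPoint MY.X)) := by
  refine ⟨fun M _ y Z fst snd h => ?_⟩
  obtain ⟨φ, rfl⟩ := Spec.map_surjective y
  letI : Algebra L M :=
    (MY.funFieldIso.inv ≫ MY.X.residue (genericPoint MY.X) ≫ φ).hom.toAlgebra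
  haveI := hdom M
  have hy : Spec.map φ ≫ MY.X.fromSpecResidueField (genericPoint MY.X) =
      Spec.map (CommRingCat.ofHom (algebraMap L M)) ≫ MY.gen := by
    rw [RingHom.algebraMap_toAlgebra, CommRingCat.ofHom_hom, Spec.map_comp, Spec.map_comp,
      Category.assoc, Category.assoc, ← ProjModel.fromSpecStalk_genericPoint_eq,
      Scheme.fromSpecResidueField]
  have big : IsPullback (fst ≫ f.fiberι (genericPoint MY.X)) snd f
      (Spec.map φ ≫ MY.X.fromSpecResidueField (genericPoint MY.X)) :=
    (h.flip.paste_vert (IsPullback.of_hasPullback f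
      (MY.X.fromSpecResidueField (genericPoint MY.X))).flip).flip
  rw [hy] at big
  exact irreducibleSpace_of_isPullback_of_isDomain_tensor MX MY f hgen _ _ big

/-- **The dimension of the generic fibre is `trdeg_L K`.** With `X`, `Y`, `f` as above, `f` a
`k`-morphism and the generic fibre `X_η` irreducible, `dim X_η = trdeg_L K`: the `K`-point
`(gen_X, Spec K → Spec κ(η))` of `X_η` is a preimmersion onto its generic point, and the dimension
of a point of a scheme locally of finite type over the field `κ(η) ≅ L` is the transcendence
degree of its residue field (Görtz–Wedhorn I, Thm. 5.22; the tree's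
`Motives.Scheme.height_eq_toENat_trdeg_of_isPreimmersion`). For de Jong's fibration
(`trdeg_L K = 1`) the generic fibre is a curve. [cite: GortzWedhorn2020, Thm. 5.22] -/
theorem topologicalKrullDim_fiber_genericPoint {k K L : Type u} [Field k] [Field K]
    [Field L] [Algebra k K] [Algebra k L] [Algebra L K] (MX : ProjModel k K) (MY : ProjModel k L)
    (f : MX.X ⟶ MY.X)
    (hgen : MX.gen ≫ f = Spec.map (CommRingCat.ofHom (algebraMap L K)) ≫ MY.gen)
    (hf : f ≫ MY.π = MX.π)
    [IrreducibleSpace (f.fiber (genericPoint MY.X))] {n : ℕ} (htr : Algebra.trdeg L K = n) :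
    topologicalKrullDim (f.fiber (genericPoint MY.X)) = n := by
  classical
  set η := genericPoint MY.X with hη
  haveI : LocallyOfFiniteType (f ≫ MY.π) := by rw [hf]; infer_instance
  haveI : LocallyOfFiniteType f := locallyOfFiniteType_of_comp f MY.π
  have hLFT : LocallyOfFiniteType (f.fiberToSpecResidueField η) :=
    inferInstanceAs (LocallyOfFiniteType (pullback.snd _ _))
  -- the residue field of `η` is `L`: `residue` is an isomorphism at the generic point
  haveI hres : IsIso (MY.X.residue η) := by
    have hfield : IsField (MY.X.presheaf.stalk η) := Field.toIsField MY.X.functionField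
    refine (ConcreteCategory.isIso_iff_bijective _).mpr ⟨?_, Ideal.Quotient.mk_surjective⟩
    rw [injective_iff_map_eq_zero]
    intro a ha
    have ha' : a ∈ IsLocalRing.maximalIdeal (MY.X.presheaf.stalk η) :=
      Ideal.Quotient.eq_zero_iff_mem.mp ha
    rwa [(IsLocalRing.isField_iff_maximalIdeal_eq).mp hfield] at ha'
  let θ : MY.X.residueField η ⟶ CommRingCat.of K :=
    inv (MY.X.residue η) ≫ MY.funFieldIso.hom ≫ CommRingCat.ofHom (algebraMap L K)
  letI algθ : Algebra (MY.X.residueField η) K := θ.hom.toAlgebra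
  have hθ : CommRingCat.ofHom (algebraMap (MY.X.residueField η) K) = θ := rfl
  -- the `K`-point of the generic fibre
  have hw : MX.gen ≫ f = Spec.map θ ≫ MY.X.fromSpecResidueField η := by
    rw [hgen, Scheme.fromSpecResidueField, Spec.map_comp, Spec.map_comp, Category.assoc,
      Category.assoc, Spec.map_inv, IsIso.inv_hom_id_assoc,
      ProjModel.specMap_funFieldIso_hom_fromSpecStalk]
  let g : Spec (CommRingCat.of K) ⟶ f.fiber η := pullback.lift MX.gen (Spec.map θ) hw
  have hgι : g ≫ f.fiberι η = MX.gen := pullback.lift_fst _ _ _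
  have hgp : g ≫ f.fiberToSpecResidueField η =
      Spec.map (CommRingCat.ofHom (algebraMap (MY.X.residueField η) K)) := by
    rw [hθ]; exact pullback.lift_snd _ _ _
  haveI : IsPreimmersion MX.gen := by
    rw [← ProjModel.specMap_funFieldIso_hom_fromSpecStalk]; infer_instance
  haveI : IsPreimmersion (g ≫ f.fiberι η) := by rw [hgι]; infer_instance
  haveI : IsPreimmersion g := IsPreimmersion.of_comp g (f.fiberι η)
  -- the dimension of the point `g(pt)` is `trdeg_{κ(η)} K = trdeg_L K`
  have hheight :=
    @Literature.AlgebraicGeometry.Motives.Scheme.height_eq_toENat_trdeg_of_isPreimmersion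
      (MY.X.residueField η) _ (f.fiber η) (f.fiberToSpecResidueField η) hLFT K _ algθ g
      inferInstance hgp
  have htr' : Algebra.trdeg (MY.X.residueField η) K = n := by
    let e : MY.X.residueField η ≅ CommRingCat.of L := asIso (inv (MY.X.residue η) ≫ MY.funFieldIso.hom)
    letI : Algebra (MY.X.residueField η) L := e.hom.hom.toAlgebra
    haveI : IsScalarTower (MY.X.residueField η) L K := IsScalarTower.of_algebraMap_eq fun c => rfl
    haveI : Algebra.IsIntegral (MY.X.residueField η) L :=
      Algebra.isIntegral_of_surjective e.commRingCatIsoToRingEquiv.surjective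
    have h := trdeg_add_eq (MY.X.residueField η) (S := L) (A := K)
    rw [trdeg_eq_zero (R := ↥(MY.X.residueField η)) (A := L), zero_add, htr] at h
    exact h.symm
  have hheight' : Order.height (g (IsLocalRing.closedPoint K)) = n :=
    hheight.trans (by rw [htr', map_natCast])
  -- `g(pt)` is the generic point of the irreducible `X_η`
  have hgpt : g (IsLocalRing.closedPoint K) = genericPoint (f.fiber η) := by
    apply (f.fiberι η).isEmbedding.injective
    rw [← Scheme.Hom.comp_apply, hgι, MX.genericPt_eq]
    have hsp : (f.fiberι η) (genericPoint (f.fiber η)) ⤳ genericPoint MX.X := by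
      rw [← MX.genericPt_eq, ← hgι, Scheme.Hom.comp_apply]
      exact ((genericPoint_specializes _).map (f.fiberι η).continuous)
    have hx : IsGenericPoint ((f.fiberι η) (genericPoint (f.fiber η))) (⊤ : Set MX.X) :=
      top_unique (by
        have huniv : closure {genericPoint MX.X} = (⊤ : Set MX.X) := (genericPoint_spec MX.X).def
        rw [← huniv]
        exact closure_minimal (Set.singleton_subset_iff.mpr hsp.mem_closure) isClosed_closure)
    exact (hx.eq (genericPoint_spec MX.X)).symm
  rw [hgpt] at hheight'
  have hdim := Literature.AlgebraicGeometry.Motives.Scheme.height_genericPoint (f.fiber η)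
  rw [hheight'] at hdim
  exact_mod_cast hdim.symm

end GenericFibre

end Summit.ResolutionOfSingularities.ResolutionOfSingularities.Theorems

end
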